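import Mathlib
import Summits.ResolutionOfSingularities.ResolutionOfSingularities.Theorems.WeightedInvariantLocalWeightedDropTOT2CurveConflictShift
import Summits.ResolutionOfSingularities.ResolutionOfSingularities.Theorems.WeightedInvariantLocalWeightedDropMonicDescentBridgeTools

/-!
# `LocalWeightedDrop`, NC count game — TOT2-LINE piece S-CRV (v1.1 (D)), part 3: graph branches SURVIVE THE `V(y,u₂)`-MOVE (fact F6 —
# how conflicts are born)

[OURS · L1 W4.3 · chain w43, engine crux `LocalWeightedDrop` stmt-ResolutionOfSingularities-8899; sub-line under the v32 registered stub
`stub_spaceNCRankDrop`, design memo `L/res-L1-w43-lead-1/g4/TOT2-LINE.md` v1.1 ADDENDUM (D); piece S-CRV = res-type-088 (res-L1-w43-plan-1 DEALS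
gen 10 #9); design note `plan/tools/res-type-088/S-CRV-D-DESIGN.md`; `--supports 8899 --as helper`, counted 0; definition-free; nothing here is a
statement of any manuscript; AI-written (gate-accepted = sorry-free with standard axioms, not refereed).]

Parts 1/2 (`…TOT2CurveConflict`, `…TOT2CurveConflictShift`) track a permissible graph branch `V(y + ψ, u₂ + u₁h(u₁))` of a label `A` under the point
blow-up (`blowOneT`, origin and translated point), re-centrings, and the `V(y,u₁)`-move (`divOneT`).  Here the remaining transport:
* **`graph_divTwoT`** (F6) — if `V(y,u₂)` is permissible for the position `A` (succT's second case, transport `divTwoT`) and `A` ALSO carries a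
  permissible graph branch with datum `h ≠ 0` (a second top-locus branch through the point), then `divTwoT d A` carries a permissible graph branch
  with the SAME datum `h`: the branch's strict transform passes through the near point and is tangent to the new boundary letter `V(u₂)` with contact
  `1 + ord h` — a B-permissibility CONFLICT IS BORN at an on-strategy move (the count (D) must charge pairwise branch contacts, not only contacts
  with boundary letters).
  PROOF (coefficient model, no geometry): write `u₂ = ũ₂ + t`, `t = u₁h`, in the sheared coordinates; (i) `u₂` is coprime to `ũ₂`
  (`X_one_pow_dvd_of_dvd_add_noY_pow_mul`: `ũ₂^a ∣ u₂^n·m ⇒ ũ₂^a ∣ m`, via the `u₂`-free part `killTwo` and `NoZeroDivisors`); (ii) reducing the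
  branch congruence `P ≡ (Y − φ)^d (mod ũ₂)` of the monic form gives `t^d · b₀ = (−φ)^d`, whence `t ∣ φ` by `d`-th-root extraction among `u₂`-free
  series (`dvd_of_pow_dvd_pow_noY`: `u₁`-adic normal form `u₁^r ·` unit) and `φ = tφ₁`, `φ₁(0) = 0`; (iii) the polynomial identity
  `u₂^d · (monic form of divTwoT, re-centred by φ₁) = (re-centred monic form of A)(u₂·Y + ũ₂φ₁)` (`Polynomial.aeval` bookkeeping with
  `WildMonic.taylor_monicPoly`) and the ideal `(ũ₂, Y)^d ⊂ k⟦u⟧[Y]` in coefficient form (`coeff_mul_dvd_of_dvd` & co.) give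
  `ũ₂^{d−n} ∣ u₂^d · (new slot n)`, and (i) removes `u₂^d`.
-/

set_option linter.dupNamespace false -- mandated namespace of this single-conjunct summit

noncomputable section

namespace Summit.ResolutionOfSingularities.ResolutionOfSingularities.Theorems

namespace TOT2Curve

open MvPowerSeries PolyDescent MonicDescent WildMonic Literature.AlgebraicGeometry.Resolution

variable {k : Type} [Field k] {d : ℕ}

/-! ## `V(y,u₂)`-permissibility as divisibility; the shear of `u₂` -/

/-- `V(y,u₂)`-permissibility slot by slot as divisibility by `u₂^{d−j}`. -/
theorem isPermissibleTwoT_iff_X_pow_dvd (A : Fin d → MvPowerSeries (Fin 2) k) :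
    IsPermissibleTwoT d A ↔ ∀ j : Fin d, X 1 ^ (d - (j : ℕ)) ∣ A j := by
  unfold IsPermissibleTwoT
  refine forall_congr' fun j => ?_
  rw [X_pow_dvd_iff]
  constructor
  · intro h m hm
    by_contra hne
    exact absurd (h m hne) (not_le.mpr hm)
  · intro h e he
    by_contra hlt
    exact he (h e (not_le.mp hlt))

/-- The shear moves `u₂` to `u₂ + u₁h`. -/
theorem shear_X_one (h : MvPowerSeries (Fin 2) k) : shear h (X 1) = X 1 + X 0 * h := by
  rw [shear_eq, subst_X (hasSubst_of_constantCoeff_zero (constantCoeff_shearFamily h))]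
  rfl

/-- The shear of `u₂^c · B`. -/
theorem shear_X_one_pow_mul (h B : MvPowerSeries (Fin 2) k) (c : ℕ) : shear h (X 1 ^ c * B) = (X 1 + X 0 * h) ^ c * shear h B := by
  rw [shear_mul, shear_eq h (X 1 ^ c), subst_pow (hasSubst_of_constantCoeff_zero (constantCoeff_shearFamily h)), ← shear_eq, shear_X_one]

/-! ## The `u₂`-free part and coprimality with `u₂` -/

/-- The `u₂`-free substitution `(u₁, u₂) ↦ (u₁, 0)` is substitutable. -/
theorem hasSubst_killTwo : HasSubst (![X 0, 0] : Fin 2 → MvPowerSeries (Fin 2) k) :=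
  hasSubst_of_constantCoeff_zero fun i => by fin_cases i <;> simp [constantCoeff_X]

/-- `u₂ ∣ F` iff the `u₂`-free part of `F` vanishes. -/
theorem X_one_dvd_iff_killTwo_eq_zero (F : MvPowerSeries (Fin 2) k) :
    X 1 ∣ F ↔ subst (![X 0, 0] : Fin 2 → MvPowerSeries (Fin 2) k) F = 0 := by
  rw [X_dvd_iff]
  constructor
  · intro h
    ext e
    rw [coeff_subst_killTwo, map_zero]
    split_ifs with he
    · exact h e he
    · rfl
  · intro h e he
    have h' := congrArg (coeff e) h
    rwa [coeff_subst_killTwo, if_pos he, map_zero] at h'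

/-- A `u₂`-free series is its own `u₂`-free part. -/
theorem killTwo_of_noY (t : MvPowerSeries (Fin 2) k) (ht : ∀ e : Fin 2 →₀ ℕ, e 1 ≠ 0 → coeff e t = 0) :
    subst (![X 0, 0] : Fin 2 → MvPowerSeries (Fin 2) k) t = t := by
  ext e
  rw [coeff_subst_killTwo]
  split_ifs with he
  · rfl
  · exact (ht e he).symm

/-- The `u₂`-free part keeps the constant term. -/
theorem constantCoeff_killTwo (F : MvPowerSeries (Fin 2) k) :
    constantCoeff (subst (![X 0, 0] : Fin 2 → MvPowerSeries (Fin 2) k) F) = constantCoeff F := by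
  rw [← coeff_zero_eq_constantCoeff_apply, coeff_subst_killTwo, if_pos (Finsupp.zero_apply), coeff_zero_eq_constantCoeff_apply]

/-- A variable is not zero. -/
theorem X_ne_zero' (i : Fin 2) : (X i : MvPowerSeries (Fin 2) k) ≠ 0 := fun h => by
  have h1 := congrArg (coeff (Finsupp.single i 1)) h
  rw [coeff_X, if_pos rfl, map_zero] at h1
  exact one_ne_zero h1

/-- `u₂` is coprime to every non-zero `u₂`-free series: `u₂ ∣ t·m ⇒ u₂ ∣ m`. -/
theorem X_one_dvd_of_dvd_noY_mul {t m : MvPowerSeries (Fin 2) k} (ht : ∀ e : Fin 2 →₀ ℕ, e 1 ≠ 0 → coeff e t = 0) (ht0 : t ≠ 0)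
    (h : X 1 ∣ t * m) : X 1 ∣ m := by
  rw [X_one_dvd_iff_killTwo_eq_zero] at h ⊢
  rw [subst_mul hasSubst_killTwo, killTwo_of_noY t ht] at h
  exact (mul_eq_zero.mp h).resolve_left ht0

/-- `u₂ ∣ (u₂ + t)·m ⇒ u₂ ∣ m` for a non-zero `u₂`-free `t`. -/
theorem X_one_dvd_of_dvd_add_noY_mul {t m : MvPowerSeries (Fin 2) k} (ht : ∀ e : Fin 2 →₀ ℕ, e 1 ≠ 0 → coeff e t = 0) (ht0 : t ≠ 0)
    (h : X 1 ∣ (X 1 + t) * m) : X 1 ∣ m := by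
  apply X_one_dvd_of_dvd_noY_mul ht ht0
  have h2 : X 1 ∣ (X 1 + t) * m - X 1 * m := dvd_sub h (dvd_mul_right _ _)
  rwa [add_mul, add_sub_cancel_left] at h2

/-- `u₂ ∣ (u₂ + t)^n·m ⇒ u₂ ∣ m`. -/
theorem X_one_dvd_of_dvd_add_noY_pow_mul {t : MvPowerSeries (Fin 2) k} (ht : ∀ e : Fin 2 →₀ ℕ, e 1 ≠ 0 → coeff e t = 0) (ht0 : t ≠ 0) :
    ∀ (n : ℕ) {m : MvPowerSeries (Fin 2) k}, X 1 ∣ (X 1 + t) ^ n * m → X 1 ∣ m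
  | 0, m, h => by rwa [pow_zero, one_mul] at h
  | n + 1, m, h => by
    rw [pow_succ', mul_assoc] at h
    exact X_one_dvd_of_dvd_add_noY_pow_mul ht ht0 n (X_one_dvd_of_dvd_add_noY_mul ht ht0 h)

/-- **COPRIMALITY of `u₂` and `u₂ + t`:** `u₂^a ∣ (u₂ + t)^n · m ⇒ u₂^a ∣ m` for a non-zero `u₂`-free `t`. -/
theorem X_one_pow_dvd_of_dvd_add_noY_pow_mul {t : MvPowerSeries (Fin 2) k} (ht : ∀ e : Fin 2 →₀ ℕ, e 1 ≠ 0 → coeff e t = 0)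
    (ht0 : t ≠ 0) (n : ℕ) : ∀ (a : ℕ) {m : MvPowerSeries (Fin 2) k}, X 1 ^ a ∣ (X 1 + t) ^ n * m → X 1 ^ a ∣ m
  | 0, m, _ => by rw [pow_zero]; exact one_dvd m
  | a + 1, m, h => by
    have h1 : X 1 ∣ m :=
      X_one_dvd_of_dvd_add_noY_pow_mul ht ht0 n ((dvd_pow_self (X 1) (Nat.succ_ne_zero a)).trans h)
    obtain ⟨m₁, rfl⟩ := h1
    rw [pow_succ', mul_left_comm, mul_dvd_mul_iff_left (X_ne_zero' 1)] at h
    rw [pow_succ']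
    exact mul_dvd_mul_left (X 1) (X_one_pow_dvd_of_dvd_add_noY_pow_mul ht ht0 n a h)

/-! ## `u₂`-free series: `u₁`-adic normal form and `d`-th roots of divisibility -/

/-- A non-zero `u₂`-free series is `u₁^r` times a unit. -/
theorem exists_eq_X_pow_mul_unit_of_noY {g : MvPowerSeries (Fin 2) k} (hg : ∀ e : Fin 2 →₀ ℕ, e 1 ≠ 0 → coeff e g = 0) (hg0 : g ≠ 0) :
    ∃ (r : ℕ) (u : MvPowerSeries (Fin 2) k), IsUnit u ∧ g = X 0 ^ r * u := by
  classical
  have hsingle : ∀ e : Fin 2 →₀ ℕ, e 1 = 0 → e = Finsupp.single 0 (e 0) := by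
    intro e he
    ext i
    fin_cases i <;> simp [he]
  have hex : ∃ n : ℕ, coeff (Finsupp.single 0 n) g ≠ 0 := by
    by_contra hno
    push Not at hno
    apply hg0
    ext e
    rw [map_zero]
    by_cases he : e 1 = 0
    · rw [hsingle e he]; exact hno _
    · exact hg e he
  refine ⟨Nat.find hex, divOne (Nat.find hex) g, ?_, ?_⟩
  · rw [isUnit_iff_constantCoeff, ← coeff_zero_eq_constantCoeff_apply, coeff_divOne, zero_add, isUnit_iff_ne_zero]
    exact Nat.find_spec hex
  · refine (X_pow_mul_divOne _ g fun e he => ?_).symm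
    by_contra hlt
    push Not at hlt
    have he1 : e 1 = 0 := by
      by_contra h1
      exact he (hg e h1)
    rw [hsingle e he1] at he
    exact Nat.find_min hex hlt he

/-- **`d`-TH ROOTS OF DIVISIBILITY** among `u₂`-free series: `t^d ∣ φ^d ⇒ t ∣ φ` (`d ≥ 1`; `k⟦u₁⟧` is a discrete valuation ring). -/
theorem dvd_of_pow_dvd_pow_noY {t φ : MvPowerSeries (Fin 2) k} (ht : ∀ e : Fin 2 →₀ ℕ, e 1 ≠ 0 → coeff e t = 0) (ht0 : t ≠ 0)
    (hφ : ∀ e : Fin 2 →₀ ℕ, e 1 ≠ 0 → coeff e φ = 0) (hd : 0 < d) (h : t ^ d ∣ φ ^ d) : t ∣ φ := by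
  by_cases hφ0 : φ = 0
  · rw [hφ0]; exact dvd_zero t
  obtain ⟨r, u, hu, rfl⟩ := exists_eq_X_pow_mul_unit_of_noY ht ht0
  obtain ⟨s, v, hv, rfl⟩ := exists_eq_X_pow_mul_unit_of_noY hφ hφ0
  have h1 : (X 0 : MvPowerSeries (Fin 2) k) ^ (r * d) ∣ X 0 ^ (s * d) := by
    rw [mul_pow, mul_pow, ← pow_mul, ← pow_mul] at h
    have h2 : (X 0 : MvPowerSeries (Fin 2) k) ^ (r * d) ∣ X 0 ^ (s * d) * v ^ d := (dvd_mul_right _ _).trans h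
    exact (hv.pow d).dvd_mul_right.mp h2
  have hrs : r * d ≤ s * d := by
    by_contra hlt
    push Not at hlt
    have h3 := (X_pow_dvd_iff.mp h1) (Finsupp.single 0 (s * d)) (by simpa using hlt)
    rw [X_pow_eq, coeff_monomial_same] at h3
    exact one_ne_zero h3
  have hrs' : r ≤ s := Nat.le_of_mul_le_mul_right hrs hd
  obtain ⟨u', hu'⟩ := hu.exists_right_inv
  refine ⟨u' * X 0 ^ (s - r) * v, ?_⟩
  calc X 0 ^ s * v = X 0 ^ r * X 0 ^ (s - r) * v := by rw [← pow_add, Nat.add_sub_cancel' hrs']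
    _ = X 0 ^ r * (u * u') * X 0 ^ (s - r) * v := by rw [hu', mul_one]
    _ = X 0 ^ r * u * (u' * X 0 ^ (s - r) * v) := by ring

/-! ## The ideal `(u₂, Y)^a ⊂ k⟦u₁,u₂⟧[Y]` in coefficient form -/

/-- Products: `Y^n`-coefficients divisible by `u₂^{a−n}` times `u₂^{b−n}` give `u₂^{a+b−n}`. -/
theorem coeff_mul_dvd_of_dvd {f g : Polynomial (MvPowerSeries (Fin 2) k)} {a b : ℕ}
    (hf : ∀ n, (X 1 : MvPowerSeries (Fin 2) k) ^ (a - n) ∣ f.coeff n) (hg : ∀ n, (X 1 : MvPowerSeries (Fin 2) k) ^ (b - n) ∣ g.coeff n) :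
    ∀ n, (X 1 : MvPowerSeries (Fin 2) k) ^ (a + b - n) ∣ (f * g).coeff n := by
  intro n
  rw [Polynomial.coeff_mul]
  refine Finset.dvd_sum fun ij hij => ?_
  have hn : ij.1 + ij.2 = n := Finset.HasAntidiagonal.mem_antidiagonal.mp hij
  have hpow : (X 1 : MvPowerSeries (Fin 2) k) ^ (a + b - n) ∣ X 1 ^ (a - ij.1) * X 1 ^ (b - ij.2) := by
    rw [← pow_add]; exact pow_dvd_pow _ (by omega)
  exact hpow.trans (mul_dvd_mul (hf ij.1) (hg ij.2))

/-- Powers: `(u₂, Y)^b`-membership of `g` gives `(u₂, Y)^{bj}`-membership of `g^j`. -/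
theorem coeff_pow_dvd_of_dvd {g : Polynomial (MvPowerSeries (Fin 2) k)} {b : ℕ} (hg : ∀ n, (X 1 : MvPowerSeries (Fin 2) k) ^ (b - n) ∣ g.coeff n) :
    ∀ (j n : ℕ), (X 1 : MvPowerSeries (Fin 2) k) ^ (b * j - n) ∣ (g ^ j).coeff n
  | 0, n => by rw [mul_zero, Nat.zero_sub, pow_zero]; exact one_dvd _
  | j + 1, n => by
    rw [pow_succ, show b * (j + 1) = b * j + b by ring]
    exact coeff_mul_dvd_of_dvd (coeff_pow_dvd_of_dvd hg j) hg n

/-- Constant multiples. -/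
theorem coeff_C_mul_dvd_of_dvd {q : MvPowerSeries (Fin 2) k} {c : ℕ} (hq : (X 1 : MvPowerSeries (Fin 2) k) ^ c ∣ q)
    {g : Polynomial (MvPowerSeries (Fin 2) k)} {b : ℕ} (hg : ∀ n, (X 1 : MvPowerSeries (Fin 2) k) ^ (b - n) ∣ g.coeff n) :
    ∀ n, (X 1 : MvPowerSeries (Fin 2) k) ^ (c + b - n) ∣ (Polynomial.C q * g).coeff n := by
  intro n
  rw [Polynomial.coeff_C_mul]
  have hpow : (X 1 : MvPowerSeries (Fin 2) k) ^ (c + b - n) ∣ X 1 ^ c * X 1 ^ (b - n) := by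
    rw [← pow_add]; exact pow_dvd_pow _ (by omega)
  exact hpow.trans (mul_dvd_mul hq (hg n))

/-- Sums. -/
theorem coeff_sum_dvd_of_dvd {ι : Type*} (s : Finset ι) (f : ι → Polynomial (MvPowerSeries (Fin 2) k)) (a : ℕ)
    (h : ∀ i ∈ s, ∀ n, (X 1 : MvPowerSeries (Fin 2) k) ^ (a - n) ∣ (f i).coeff n) :
    ∀ n, (X 1 : MvPowerSeries (Fin 2) k) ^ (a - n) ∣ (∑ i ∈ s, f i).coeff n := by
  intro n
  rw [Polynomial.finsetSum_coeff]
  exact Finset.dvd_sum fun i hi => h i hi n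

/-- The linear polynomial `w·Y + c` with `u₂ ∣ c` lies in `(u₂, Y)`. -/
theorem coeff_linear_dvd (w c : MvPowerSeries (Fin 2) k) (hc : X 1 ∣ c) :
    ∀ n, (X 1 : MvPowerSeries (Fin 2) k) ^ (1 - n) ∣ (Polynomial.C w * Polynomial.X + Polynomial.C c).coeff n
  | 0 => by
    rw [Polynomial.coeff_add, Polynomial.coeff_C_zero, Polynomial.mul_coeff_zero, Polynomial.coeff_X_zero, mul_zero, zero_add,
      Nat.sub_zero, pow_one]
    exact hc
  | n + 1 => by
    rw [show 1 - (n + 1) = 0 by omega, pow_zero]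
    exact one_dvd _

/-! ## (F6) Graph branches survive the `V(y,u₂)`-move -/

/-- **(F6) GRAPH BRANCHES SURVIVE `divTwoT`; CONFLICTS ARE BORN HERE.**  Let `A` be a position for which `V(y,u₂)` is permissible and which
carries a permissible graph branch `V(y + ψ, u₂ + u₁h)` with `u₁`-only datum `h ≠ 0` (no hypothesis on `ψ` is needed).  Then `divTwoT d A` (the label after blowing up `V(y,u₂)`)
carries a permissible graph branch with the SAME datum `h` (and a re-centring without constant term): the strict transform of the branch passes
through the near point, tangent to the new boundary letter `V(u₂)` with contact `1 + ord h`. -/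
theorem graph_divTwoT (hd : 0 < d) (A : Fin d → MvPowerSeries (Fin 2) k) (hA : IsPosT d A) (hA2 : IsPermissibleTwoT d A)
    (h ψ : MvPowerSeries (Fin 2) k) (hh : ∀ e : Fin 2 →₀ ℕ, e 1 ≠ 0 → coeff e h = 0) (hh0 : h ≠ 0)
    (hperm : IsPermissibleTwoT d (shift d (shearT h A) ψ)) :
    ∃ ψ' : MvPowerSeries (Fin 2) k, constantCoeff ψ' = 0 ∧ IsPermissibleTwoT d (shift d (shearT h (divTwoT d A)) ψ') := by
  classical
  -- the old letter `u₂ = ũ₂ + t`, `t = u₁h`, in the sheared coordinates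
  set t : MvPowerSeries (Fin 2) k := X 0 * h with ht
  have ht_noY : ∀ e : Fin 2 →₀ ℕ, e 1 ≠ 0 → coeff e t = 0 := by
    intro e he
    rw [ht, X, coeff_monomial_mul]
    split_ifs with hle
    · rw [hh _ (by simpa using he), mul_zero]
    · rfl
  have ht0 : t ≠ 0 := mul_ne_zero (X_ne_zero' 0) hh0
  set B := divTwoT d A with hB
  set Bs := shearT h B with hBs
  -- (1) `A_j = u₂^{d−j} B_j`, hence `shearT h A j = (ũ₂ + t)^{d−j} · Bs j`
  have hAB : ∀ j : Fin d, A j = X 1 ^ (d - (j : ℕ)) * B j := fun j => (X_pow_mul_divTwo _ _ (hA2 j)).symm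
  have hAs : ∀ j : Fin d, shearT h A j = (X 1 + t) ^ (d - (j : ℕ)) * Bs j := by
    intro j
    show shear h (A j) = (X 1 + t) ^ _ * shear h (B j)
    rw [hAB j, shear_X_one_pow_mul]
  -- (2) the `u₂`-free re-centring `φ = ψ(u₁, 0)` presents the same branch
  set φ := subst (![X 0, 0] : Fin 2 → MvPowerSeries (Fin 2) k) ψ with hφ
  have hperm₀ : IsPermissibleTwoT d (shift d (shearT h A) φ) := isPermissibleTwoT_shift_killTwo hperm
  have hφ_noY : ∀ e : Fin 2 →₀ ℕ, e 1 ≠ 0 → coeff e φ = 0 := fun e he => by rw [hφ, coeff_subst_killTwo, if_neg he]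
  set S := shift d (shearT h A) φ with hS
  have hSdvd : ∀ j : Fin d, X 1 ^ (d - (j : ℕ)) ∣ S j := (isPermissibleTwoT_iff_X_pow_dvd S).mp hperm₀
  -- (3) reduction mod `ũ₂`: the ring map `K = killTwo`
  obtain ⟨K, hKapply⟩ : ∃ K : MvPowerSeries (Fin 2) k →+* MvPowerSeries (Fin 2) k,
      ∀ F, K F = subst (![X 0, 0] : Fin 2 → MvPowerSeries (Fin 2) k) F :=
    ⟨(substAlgHom (hasSubst_killTwo (k := k))).toRingHom, fun F => by
      rw [AlgHom.toRingHom_eq_coe, RingHom.coe_coe, coe_substAlgHom]⟩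
  have hKX1 : K (X 1) = 0 := by
    rw [hKapply, subst_X hasSubst_killTwo]
    rfl
  have hKt : K t = t := by rw [hKapply, killTwo_of_noY t ht_noY]
  have hKw : K (X 1 + t) = t := by rw [map_add, hKX1, hKt, zero_add]
  have hKφ : K φ = φ := by rw [hKapply, killTwo_of_noY φ hφ_noY]
  have hKS : ∀ j : Fin d, K (S j) = 0 := fun j => by
    rw [hKapply, ← X_one_dvd_iff_killTwo_eq_zero]
    exact (dvd_pow_self _ (by have := j.2; omega)).trans (hSdvd j)
  -- the branch congruence `P ≡ (Y − φ)^d (mod ũ₂)` for the monic form `P` of `shearT h A`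
  have hP : monicPoly d (shearT h A) = Polynomial.taylor (-φ) (monicPoly d S) := by
    rw [taylor_monicPoly, hS, PolyDescent.shift_shift_neg]
  have hmapS : (monicPoly d S).map K = Polynomial.X ^ d := by
    unfold monicPoly
    rw [Polynomial.map_add, Polynomial.map_pow, Polynomial.map_X, Polynomial.map_sum]
    simp only [Polynomial.map_mul, Polynomial.map_C, hKS, map_zero, zero_mul, Finset.sum_const_zero, add_zero]
  have hmapP : (monicPoly d (shearT h A)).map K = (Polynomial.X + Polynomial.C (-φ)) ^ d := by
    rw [hP, Polynomial.taylor_apply, Polynomial.map_comp, hmapS, Polynomial.map_add, Polynomial.map_X, Polynomial.map_C,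
      map_neg, hKφ, Polynomial.X_pow_comp]
  -- constant coefficients: `t^d · K(Bs 0) = (−φ)^d`
  have hc0 : K (shearT h A ⟨0, hd⟩) = (-φ) ^ d := by
    have h1 : ((monicPoly d (shearT h A)).map K).coeff 0 = ((Polynomial.X + Polynomial.C (-φ)) ^ d).coeff 0 := by rw [hmapP]
    have h2 : (monicPoly d (shearT h A)).coeff 0 = shearT h A ⟨0, hd⟩ := coeff_monicPoly_of_lt d _ ⟨0, hd⟩
    rwa [Polynomial.coeff_map, h2, Polynomial.coeff_X_add_C_pow, Nat.sub_zero, Nat.choose_zero_right, Nat.cast_one, mul_one] at h1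
  have hkey0 : t ^ d * K (Bs ⟨0, hd⟩) = (-φ) ^ d := by
    rw [← hc0, hAs ⟨0, hd⟩, map_mul, map_pow, hKw, Nat.sub_zero]
  -- (4) `t ∣ φ`: `φ = t·φ₁` with `φ₁(0) = 0`
  have htφ : t ∣ φ := by
    apply dvd_of_pow_dvd_pow_noY ht_noY ht0 hφ_noY hd
    have h1 : t ^ d ∣ (-φ) ^ d := ⟨K (Bs ⟨0, hd⟩), hkey0.symm⟩
    rwa [neg_pow, (isUnit_neg_one.pow d).dvd_mul_left] at h1
  obtain ⟨φ₁, hφ₁⟩ := htφ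
  have hB0 : constantCoeff (Bs ⟨0, hd⟩) = 0 := by
    show constantCoeff (shear h (divTwo (d - 0) (A ⟨0, hd⟩))) = 0
    apply constantCoeff_shear_eq_zero
    rw [← coeff_zero_eq_constantCoeff_apply, coeff_divTwo, zero_add, Nat.sub_zero]
    apply coeff_of_lt_order
    have h1 := hA ⟨0, hd⟩
    rw [Nat.sub_zero] at h1
    rwa [Finsupp.degree_single]
  have hφ₁0 : constantCoeff φ₁ = 0 := by
    have h1 : t ^ d * K (Bs ⟨0, hd⟩) = t ^ d * ((-1) ^ d * φ₁ ^ d) := by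
      rw [hkey0, hφ₁, neg_pow, mul_pow]; ring
    have h2 : K (Bs ⟨0, hd⟩) = (-1) ^ d * φ₁ ^ d := mul_left_cancel₀ (pow_ne_zero d ht0) h1
    have h3 := congrArg constantCoeff h2
    rw [hKapply, constantCoeff_killTwo, hB0, map_mul, map_pow, map_pow, map_neg, map_one] at h3
    have h4 : constantCoeff φ₁ ^ d = 0 := by
      rcases mul_eq_zero.mp h3.symm with h5 | h5
      · exact absurd h5 (pow_ne_zero d (neg_ne_zero.mpr one_ne_zero))
      · exact h5
    exact (pow_eq_zero_iff hd.ne').mp h4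
  -- (5) the polynomial identity `u₂^d · (re-centred monic form of Bs) = (monic form of S)(u₂·Y + ũ₂φ₁)`
  have hwφ : X 1 * φ₁ + φ = (X 1 + t) * φ₁ := by rw [hφ₁]; ring
  set g : Polynomial (MvPowerSeries (Fin 2) k) := Polynomial.C (X 1 + t) * Polynomial.X + Polynomial.C (X 1 * φ₁) with hg
  have hhom : Polynomial.aeval (Polynomial.C (X 1 + t) * Polynomial.X) (monicPoly d (shearT h A)) =
      Polynomial.C ((X 1 + t) ^ d) * monicPoly d Bs := by
    unfold monicPoly
    rw [map_add, map_pow, Polynomial.aeval_X, map_sum, mul_add, Finset.mul_sum, mul_pow, ← map_pow]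
    congr 1
    refine Finset.sum_congr rfl fun j _ => ?_
    have hdj : (X 1 + t) ^ (d - (j : ℕ)) * (X 1 + t) ^ (j : ℕ) = (X 1 + t) ^ d := by
      rw [← pow_add, Nat.sub_add_cancel j.2.le]
    rw [map_mul, Polynomial.aeval_C, Polynomial.algebraMap_eq, map_pow, Polynomial.aeval_X, hAs j, mul_pow, ← map_pow, ← hdj,
      map_mul, map_mul]
    ring
  have hmain : Polynomial.aeval g (monicPoly d S) = Polynomial.C ((X 1 + t) ^ d) * monicPoly d (shift d Bs φ₁) := by
    have h1 : monicPoly d S = Polynomial.aeval (Polynomial.X + Polynomial.C φ) (monicPoly d (shearT h A)) := by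
      rw [hS, ← taylor_monicPoly, Polynomial.taylor_apply, Polynomial.comp_eq_aeval]
    have h2 : Polynomial.aeval g (Polynomial.X + Polynomial.C φ : Polynomial (MvPowerSeries (Fin 2) k)) =
        Polynomial.C (X 1 + t) * (Polynomial.X + Polynomial.C φ₁) := by
      rw [map_add, Polynomial.aeval_X, Polynomial.aeval_C, Polynomial.algebraMap_eq, hg, add_assoc, ← map_add, hwφ, map_mul]
      ring
    have h3 : Polynomial.aeval (Polynomial.X + Polynomial.C φ₁ : Polynomial (MvPowerSeries (Fin 2) k)) (Polynomial.C (X 1 + t) * Polynomial.X) =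
        Polynomial.C (X 1 + t) * (Polynomial.X + Polynomial.C φ₁) := by
      rw [map_mul, Polynomial.aeval_C, Polynomial.algebraMap_eq, Polynomial.aeval_X]
    rw [h1, ← Polynomial.aeval_algHom_apply, h2, ← h3, Polynomial.aeval_algHom_apply, hhom, map_mul, Polynomial.aeval_C,
      Polynomial.algebraMap_eq, ← Polynomial.comp_eq_aeval, ← Polynomial.taylor_apply, taylor_monicPoly]
  -- (6) the left side lies in `(ũ₂, Y)^d`
  have hSdeg : (monicPoly d S).natDegree < d + 1 := Nat.lt_succ_of_le (natDegree_monicPoly_le d S)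
  have hg1 : ∀ n, (X 1 : MvPowerSeries (Fin 2) k) ^ (1 - n) ∣ g.coeff n := coeff_linear_dvd (X 1 + t) _ (dvd_mul_right _ _)
  have hgood : ∀ n, (X 1 : MvPowerSeries (Fin 2) k) ^ (d - n) ∣ (Polynomial.aeval g (monicPoly d S)).coeff n := by
    rw [Polynomial.as_sum_range_C_mul_X_pow' _ hSdeg, map_sum]
    apply coeff_sum_dvd_of_dvd
    intro i hi n
    have hi' : i ≤ d := Nat.lt_succ_iff.mp (Finset.mem_range.mp hi)
    have hq : (X 1 : MvPowerSeries (Fin 2) k) ^ (d - i) ∣ (monicPoly d S).coeff i := by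
      rcases Nat.lt_or_ge i d with hlt | hge
      · rw [coeff_monicPoly_of_lt d S ⟨i, hlt⟩]; exact hSdvd ⟨i, hlt⟩
      · rw [Nat.sub_eq_zero_of_le hge, pow_zero]; exact one_dvd _
    rw [map_mul, map_pow, Polynomial.aeval_X, Polynomial.aeval_C, Polynomial.algebraMap_eq]
    have h1 := coeff_C_mul_dvd_of_dvd hq (coeff_pow_dvd_of_dvd hg1 i) n
    rwa [one_mul, Nat.sub_add_cancel hi'] at h1
  -- (7) remove `u₂^d` by coprimality
  refine ⟨φ₁, hφ₁0, ?_⟩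
  rw [isPermissibleTwoT_iff_X_pow_dvd]
  intro j
  have h1 := hgood j
  rw [hmain, Polynomial.coeff_C_mul, coeff_monicPoly_of_lt d _ j] at h1
  exact X_one_pow_dvd_of_dvd_add_noY_pow_mul ht_noY ht0 d (d - j) h1

/-- (F6) for the predicate: a label with permissible `V(y,u₂)` and a graph branch whose datum is NOT zero keeps `HasGraphCurveT` after `divTwoT`
(with the same datum). -/
theorem hasGraphCurveT_divTwoT (hd : 0 < d) (A : Fin d → MvPowerSeries (Fin 2) k) (hA : IsPosT d A) (hA2 : IsPermissibleTwoT d A)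
    (h ψ : MvPowerSeries (Fin 2) k) (hh : ∀ e : Fin 2 →₀ ℕ, e 1 ≠ 0 → coeff e h = 0) (hh0 : h ≠ 0)
    (hperm : IsPermissibleTwoT d (shift d (shearT h A) ψ)) : HasGraphCurveT d (divTwoT d A) := by
  obtain ⟨ψ', hψ', hperm'⟩ := graph_divTwoT hd A hA hA2 h ψ hh hh0 hperm
  exact ⟨h, ψ', hh, hψ', hperm'⟩

end TOT2Curve

end Summit.ResolutionOfSingularities.ResolutionOfSingularities.Theorems

end
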